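import Literature.Barriers.Parity.HensleyRichards
import Mathlib.Analysis.SpecialFunctions.Pow.Real
import HarnessLib

/-!
# `π(n) ≤ (4/3)·n/log n` for the integers `60 ≤ n ≤ 1023`, by kernel computation

Topic `Literature/IUT/LogVolume` (support file for `EtaPrmSixty.lean`: the explicit admissible value
`η_prm = 60` in [IUTchIV] Prop. 1.6 / Joshi's [ATS IV] Prop. 6.2.1). Pure proof file (no definitions, nothing
asserted). The range `60 ≤ n ≤ 1023` is covered by 19 blocks `[c, c')`: on each, `π(n) ≤ π(c' − 1) =: K`
(certified by Legendre's identity `Literature.Barriers.Parity.primeCounting_eq_add_card_coprime_factorial` with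
`s = 31` and `decide`), and `3·K·log c ≤ 4·c` (certified as the integer inequality `c^{3K}·500^{4c} ≤ 1359^{4c}`,
using `1359/500 = 2.718 < e`), whence `3·π(n)·log n ≤ 4·n` for `c ≤ n < c'` by the monotonicity of `t/log t`
on `[e, ∞)`. Main result: `three_mul_primeCounting_mul_log_le` (`60 ≤ n ≤ 1023`). Classical and undisputed
(cf. Rosser–Schoenfeld 1962 (3.6): `π(x) < 1.25506·x/log x` for `x > 1`, not used). Standard axioms only.
-/

namespace Literature.IUT.LogVolume

namespace EtaPrmSixty

open Real
open scoped Nat.Prime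

/-! ## Real-analysis glue -/

/-- `t/log t` is monotone on `[e, ∞)` (from Mathlib's `Real.log_div_self_antitoneOn`), in the form used for the
blocks: `e ≤ a ≤ b ⟹ a/log a ≤ b/log b`. [folklore] -/
private theorem div_log_mono {a b : ℝ} (ha : Real.exp 1 ≤ a) (hab : a ≤ b) : a / Real.log a ≤ b / Real.log b := by
  have hb : Real.exp 1 ≤ b := le_trans ha hab
  have h := Real.log_div_self_antitoneOn ha hb hab
  have ha0 : 0 < a := lt_of_lt_of_le (Real.exp_pos 1) ha
  have hb0 : 0 < b := lt_of_lt_of_le (Real.exp_pos 1) hb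
  have hla : 0 < Real.log a := by
    have : (1 : ℝ) ≤ Real.log a := by rw [← Real.log_exp 1]; exact Real.log_le_log (Real.exp_pos 1) ha
    linarith
  have hlb : 0 < Real.log b := by
    have : (1 : ℝ) ≤ Real.log b := by rw [← Real.log_exp 1]; exact Real.log_le_log (Real.exp_pos 1) hb
    linarith
  -- `log b / b ≤ log a / a` ⟹ `a / log a ≤ b / log b`
  rw [div_le_div_iff₀ hla hlb]
  have h' : Real.log b / b ≤ Real.log a / a := h
  rw [div_le_div_iff₀ hb0 ha0] at h'
  linarith

/-- `2.718 = 1359/500 < e`. [folklore] -/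
private theorem ratio_lt_exp_one : (1359 / 500 : ℝ) < Real.exp 1 := by
  have := Real.exp_one_gt_d9; linarith

/-- The integer certificate of a block: `c^{3K}·500^{4c} ≤ 1359^{4c}` gives `3·K·log c ≤ 4·c` (take logarithms and use
`log(1359/500) ≤ 1`). [folklore] -/
private theorem three_mul_log_le_of_pow_le {c K : ℕ} (hc : 1 ≤ c)
    (h : c ^ (3 * K) * 500 ^ (4 * c) ≤ 1359 ^ (4 * c)) :
    3 * (K : ℝ) * Real.log c ≤ 4 * c := by
  have hc0 : (0 : ℝ) < c := by exact_mod_cast hc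
  have hR : ((c : ℝ) ^ (3 * K)) * (500 : ℝ) ^ (4 * c) ≤ (1359 : ℝ) ^ (4 * c) := by exact_mod_cast h
  have h1 : (c : ℝ) ^ (3 * K) ≤ (1359 / 500 : ℝ) ^ (4 * c) := by
    rw [div_pow, le_div_iff₀ (by positivity)]; exact hR
  have h2 := Real.log_le_log (by positivity) h1
  rw [Real.log_pow, Real.log_pow] at h2
  have h3 : Real.log (1359 / 500 : ℝ) ≤ 1 := by
    have := Real.log_lt_log (by norm_num) ratio_lt_exp_one
    rw [Real.log_exp] at this; exact this.le
  have h4 : ((4 * c : ℕ) : ℝ) * Real.log (1359 / 500 : ℝ) ≤ ((4 * c : ℕ) : ℝ) * 1 :=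
    mul_le_mul_of_nonneg_left h3 (by positivity)
  push_cast at h2 h4 ⊢
  linarith

/-- **One block**: if `π(c' − 1) ≤ K` and `3·K·log c ≤ 4·c` with `c ≥ 3 (> e)`, then `3·π(n)·log n ≤ 4·n` for every
`c ≤ n < c'`. [folklore] -/
private theorem block {c c' K : ℕ} (hc : 3 ≤ c) (hK : π (c' - 1) ≤ K) (hlog : 3 * (K : ℝ) * Real.log c ≤ 4 * c)
    {n : ℕ} (hcn : c ≤ n) (hnc : n < c') : 3 * (π n : ℝ) * Real.log n ≤ 4 * n := by
  have hpi : π n ≤ K := le_trans (Nat.monotone_primeCounting (by omega)) hK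
  have hc0 : (0 : ℝ) < c := by exact_mod_cast (show 0 < c by omega)
  have hn0 : (0 : ℝ) < n := by exact_mod_cast (show 0 < n by omega)
  have he : Real.exp 1 ≤ (c : ℝ) := by
    have := Real.exp_one_lt_d9
    have h3 : (3 : ℝ) ≤ c := by exact_mod_cast hc
    linarith
  have hmono := div_log_mono he (show (c : ℝ) ≤ n by exact_mod_cast hcn)
  have h3c : (3 : ℝ) ≤ c := by exact_mod_cast hc
  have h3n : (3 : ℝ) ≤ n := by exact_mod_cast (le_trans hc hcn)
  have hlc : 0 < Real.log (c : ℝ) := Real.log_pos (by linarith)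
  have hln : 0 < Real.log (n : ℝ) := Real.log_pos (by linarith)
  have hK' : (K : ℝ) ≤ 4 * c / (3 * Real.log c) := by
    rw [le_div_iff₀ (by positivity)]; linarith
  have hstep : 4 * (c : ℝ) / (3 * Real.log c) ≤ 4 * n / (3 * Real.log n) := by
    have := hmono
    calc 4 * (c : ℝ) / (3 * Real.log c) = 4 / 3 * (c / Real.log c) := by ring
      _ ≤ 4 / 3 * (n / Real.log n) := by gcongr
      _ = 4 * n / (3 * Real.log n) := by ring
  have hpiR : (π n : ℝ) ≤ K := by exact_mod_cast hpi
  have hfin : (π n : ℝ) ≤ 4 * n / (3 * Real.log n) := hpiR.trans (hK'.trans hstep)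
  rw [le_div_iff₀ (by positivity)] at hfin
  linarith

/-! ## The 19 certified blocks -/

/-- `π(70) = 19` (Legendre's identity with `s = 31`, kernel count). [folklore] -/
private theorem primeCounting_70 : π 70 = 19 := by
  rw [Literature.Barriers.Parity.primeCounting_eq_add_card_coprime_factorial (s := 31) (by norm_num) (by norm_num)]
  decide +kernel

/-- Block `[60, 71)`: certificate `60^(3·19)·500^(4·60) ≤ 1359^(4·60)`. [folklore] -/
private theorem cert_60 : (60 : ℕ) ^ (3 * 19) * 500 ^ (4 * 60) ≤ 1359 ^ (4 * 60) := by decide +kernel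

/-- `π(82) = 22` (Legendre's identity with `s = 31`, kernel count). [folklore] -/
private theorem primeCounting_82 : π 82 = 22 := by
  rw [Literature.Barriers.Parity.primeCounting_eq_add_card_coprime_factorial (s := 31) (by norm_num) (by norm_num)]
  decide +kernel

/-- Block `[71, 83)`: certificate `71^(3·22)·500^(4·71) ≤ 1359^(4·71)`. [folklore] -/
private theorem cert_71 : (71 : ℕ) ^ (3 * 22) * 500 ^ (4 * 71) ≤ 1359 ^ (4 * 71) := by decide +kernel

/-- `π(100) = 25` (Legendre's identity with `s = 31`, kernel count). [folklore] -/
private theorem primeCounting_100 : π 100 = 25 := by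
  rw [Literature.Barriers.Parity.primeCounting_eq_add_card_coprime_factorial (s := 31) (by norm_num) (by norm_num)]
  decide +kernel

/-- Block `[83, 101)`: certificate `83^(3·25)·500^(4·83) ≤ 1359^(4·83)`. [folklore] -/
private theorem cert_83 : (83 : ℕ) ^ (3 * 25) * 500 ^ (4 * 83) ≤ 1359 ^ (4 * 83) := by decide +kernel

/-- `π(112) = 29` (Legendre's identity with `s = 31`, kernel count). [folklore] -/
private theorem primeCounting_112 : π 112 = 29 := by
  rw [Literature.Barriers.Parity.primeCounting_eq_add_card_coprime_factorial (s := 31) (by norm_num) (by norm_num)]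
  decide +kernel

/-- Block `[101, 113)`: certificate `101^(3·29)·500^(4·101) ≤ 1359^(4·101)`. [folklore] -/
private theorem cert_101 : (101 : ℕ) ^ (3 * 29) * 500 ^ (4 * 101) ≤ 1359 ^ (4 * 101) := by decide +kernel

/-- `π(130) = 31` (Legendre's identity with `s = 31`, kernel count). [folklore] -/
private theorem primeCounting_130 : π 130 = 31 := by
  rw [Literature.Barriers.Parity.primeCounting_eq_add_card_coprime_factorial (s := 31) (by norm_num) (by norm_num)]
  decide +kernel

/-- Block `[113, 131)`: certificate `113^(3·31)·500^(4·113) ≤ 1359^(4·113)`. [folklore] -/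
private theorem cert_113 : (113 : ℕ) ^ (3 * 31) * 500 ^ (4 * 113) ≤ 1359 ^ (4 * 113) := by decide +kernel

/-- `π(150) = 35` (Legendre's identity with `s = 31`, kernel count). [folklore] -/
private theorem primeCounting_150 : π 150 = 35 := by
  rw [Literature.Barriers.Parity.primeCounting_eq_add_card_coprime_factorial (s := 31) (by norm_num) (by norm_num)]
  decide +kernel

/-- Block `[131, 151)`: certificate `131^(3·35)·500^(4·131) ≤ 1359^(4·131)`. [folklore] -/
private theorem cert_131 : (131 : ℕ) ^ (3 * 35) * 500 ^ (4 * 131) ≤ 1359 ^ (4 * 131) := by decide +kernel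

/-- `π(178) = 40` (Legendre's identity with `s = 31`, kernel count). [folklore] -/
private theorem primeCounting_178 : π 178 = 40 := by
  rw [Literature.Barriers.Parity.primeCounting_eq_add_card_coprime_factorial (s := 31) (by norm_num) (by norm_num)]
  decide +kernel

/-- Block `[151, 179)`: certificate `151^(3·40)·500^(4·151) ≤ 1359^(4·151)`. [folklore] -/
private theorem cert_151 : (151 : ℕ) ^ (3 * 40) * 500 ^ (4 * 151) ≤ 1359 ^ (4 * 151) := by decide +kernel

/-- `π(210) = 46` (Legendre's identity with `s = 31`, kernel count). [folklore] -/
private theorem primeCounting_210 : π 210 = 46 := by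
  rw [Literature.Barriers.Parity.primeCounting_eq_add_card_coprime_factorial (s := 31) (by norm_num) (by norm_num)]
  decide +kernel

/-- Block `[179, 211)`: certificate `179^(3·46)·500^(4·179) ≤ 1359^(4·179)`. [folklore] -/
private theorem cert_179 : (179 : ℕ) ^ (3 * 46) * 500 ^ (4 * 179) ≤ 1359 ^ (4 * 179) := by decide +kernel

/-- `π(240) = 52` (Legendre's identity with `s = 31`, kernel count). [folklore] -/
private theorem primeCounting_240 : π 240 = 52 := by
  rw [Literature.Barriers.Parity.primeCounting_eq_add_card_coprime_factorial (s := 31) (by norm_num) (by norm_num)]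
  decide +kernel

/-- Block `[211, 241)`: certificate `211^(3·52)·500^(4·211) ≤ 1359^(4·211)`. [folklore] -/
private theorem cert_211 : (211 : ℕ) ^ (3 * 52) * 500 ^ (4 * 211) ≤ 1359 ^ (4 * 211) := by decide +kernel

/-- `π(276) = 58` (Legendre's identity with `s = 31`, kernel count). [folklore] -/
private theorem primeCounting_276 : π 276 = 58 := by
  rw [Literature.Barriers.Parity.primeCounting_eq_add_card_coprime_factorial (s := 31) (by norm_num) (by norm_num)]
  decide +kernel

/-- Block `[241, 277)`: certificate `241^(3·58)·500^(4·241) ≤ 1359^(4·241)`. [folklore] -/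
private theorem cert_241 : (241 : ℕ) ^ (3 * 58) * 500 ^ (4 * 241) ≤ 1359 ^ (4 * 241) := by decide +kernel

/-- `π(316) = 65` (Legendre's identity with `s = 31`, kernel count). [folklore] -/
private theorem primeCounting_316 : π 316 = 65 := by
  rw [Literature.Barriers.Parity.primeCounting_eq_add_card_coprime_factorial (s := 31) (by norm_num) (by norm_num)]
  decide +kernel

/-- Block `[277, 317)`: certificate `277^(3·65)·500^(4·277) ≤ 1359^(4·277)`. [folklore] -/
private theorem cert_277 : (277 : ℕ) ^ (3 * 65) * 500 ^ (4 * 277) ≤ 1359 ^ (4 * 277) := by decide +kernel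

/-- `π(372) = 73` (Legendre's identity with `s = 31`, kernel count). [folklore] -/
private theorem primeCounting_372 : π 372 = 73 := by
  rw [Literature.Barriers.Parity.primeCounting_eq_add_card_coprime_factorial (s := 31) (by norm_num) (by norm_num)]
  decide +kernel

/-- Block `[317, 373)`: certificate `317^(3·73)·500^(4·317) ≤ 1359^(4·317)`. [folklore] -/
private theorem cert_317 : (317 : ℕ) ^ (3 * 73) * 500 ^ (4 * 317) ≤ 1359 ^ (4 * 317) := by decide +kernel

/-- `π(432) = 83` (Legendre's identity with `s = 31`, kernel count). [folklore] -/
private theorem primeCounting_432 : π 432 = 83 := by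
  rw [Literature.Barriers.Parity.primeCounting_eq_add_card_coprime_factorial (s := 31) (by norm_num) (by norm_num)]
  decide +kernel

/-- Block `[373, 433)`: certificate `373^(3·83)·500^(4·373) ≤ 1359^(4·373)`. [folklore] -/
private theorem cert_373 : (373 : ℕ) ^ (3 * 83) * 500 ^ (4 * 373) ≤ 1359 ^ (4 * 373) := by decide +kernel

/-- `π(502) = 95` (Legendre's identity with `s = 31`, kernel count). [folklore] -/
private theorem primeCounting_502 : π 502 = 95 := by
  rw [Literature.Barriers.Parity.primeCounting_eq_add_card_coprime_factorial (s := 31) (by norm_num) (by norm_num)]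
  decide +kernel

/-- Block `[433, 503)`: certificate `433^(3·95)·500^(4·433) ≤ 1359^(4·433)`. [folklore] -/
private theorem cert_433 : (433 : ℕ) ^ (3 * 95) * 500 ^ (4 * 433) ≤ 1359 ^ (4 * 433) := by decide +kernel

/-- `π(592) = 107` (Legendre's identity with `s = 31`, kernel count). [folklore] -/
private theorem primeCounting_592 : π 592 = 107 := by
  rw [Literature.Barriers.Parity.primeCounting_eq_add_card_coprime_factorial (s := 31) (by norm_num) (by norm_num)]
  decide +kernel

/-- Block `[503, 593)`: certificate `503^(3·107)·500^(4·503) ≤ 1359^(4·503)`. [folklore] -/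
private theorem cert_503 : (503 : ℕ) ^ (3 * 107) * 500 ^ (4 * 503) ≤ 1359 ^ (4 * 503) := by decide +kernel

/-- `π(682) = 123` (Legendre's identity with `s = 31`, kernel count). [folklore] -/
private theorem primeCounting_682 : π 682 = 123 := by
  rw [Literature.Barriers.Parity.primeCounting_eq_add_card_coprime_factorial (s := 31) (by norm_num) (by norm_num)]
  decide +kernel

/-- Block `[593, 683)`: certificate `593^(3·123)·500^(4·593) ≤ 1359^(4·593)`. [folklore] -/
private theorem cert_593 : (593 : ℕ) ^ (3 * 123) * 500 ^ (4 * 593) ≤ 1359 ^ (4 * 593) := by decide +kernel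

/-- `π(808) = 139` (Legendre's identity with `s = 31`, kernel count). [folklore] -/
private theorem primeCounting_808 : π 808 = 139 := by
  rw [Literature.Barriers.Parity.primeCounting_eq_add_card_coprime_factorial (s := 31) (by norm_num) (by norm_num)]
  decide +kernel

/-- Block `[683, 809)`: certificate `683^(3·139)·500^(4·683) ≤ 1359^(4·683)`. [folklore] -/
private theorem cert_683 : (683 : ℕ) ^ (3 * 139) * 500 ^ (4 * 683) ≤ 1359 ^ (4 * 683) := by decide +kernel

/-- `π(952) = 161` (Legendre's identity with `s = 31`, kernel count). [folklore] -/
private theorem primeCounting_952 : π 952 = 161 := by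
  rw [Literature.Barriers.Parity.primeCounting_eq_add_card_coprime_factorial (s := 31) (by norm_num) (by norm_num)]
  decide +kernel

/-- Block `[809, 953)`: certificate `809^(3·161)·500^(4·809) ≤ 1359^(4·809)`. [folklore] -/
private theorem cert_809 : (809 : ℕ) ^ (3 * 161) * 500 ^ (4 * 809) ≤ 1359 ^ (4 * 809) := by decide +kernel

/-- `π(1023) = 172` (Legendre's identity with `s = 31`, kernel count). [folklore] -/
private theorem primeCounting_1023 : π 1023 = 172 := by
  rw [Literature.Barriers.Parity.primeCounting_eq_add_card_coprime_factorial (s := 31) (by norm_num) (by norm_num)]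
  decide +kernel

/-- Block `[953, 1024)`: certificate `953^(3·172)·500^(4·953) ≤ 1359^(4·953)`. [folklore] -/
private theorem cert_953 : (953 : ℕ) ^ (3 * 172) * 500 ^ (4 * 953) ≤ 1359 ^ (4 * 953) := by decide +kernel

/-! ## Assembly -/

/-- **`3·π(n)·log n ≤ 4·n` for every integer `60 ≤ n ≤ 1023`**, i.e. `π(n) ≤ (4/3)·n/log n` there — the finite
part of the explicit value `η_prm = 60` in [IUTchIV] Prop. 1.6 («`Σ_{p ≤ η} 1 ≤ 4η/(3·log η)` for `η ≥ η_prm`») /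
Joshi [ATS IV] Prop. 6.2.1; a weak form (constant `4/3 > 1.25506`, `n ≥ 60`) of Rosser–Schoenfeld's (3.6)
«`π(x) < 1.25506·x/log x` for `1 < x`». PROVED by the 19 kernel-certified blocks above.
[cite: RosserSchoenfeld1962, Cor. 1 eq. (3.6) (weak form: constant 4/3, 60 ≤ n ≤ 1023)] -/
theorem three_mul_primeCounting_mul_log_le {n : ℕ} (h60 : 60 ≤ n) (h1023 : n ≤ 1023) :
    3 * (π n : ℝ) * Real.log n ≤ 4 * n := by
  rcases lt_or_ge n 71 with h0 | h0g
  · exact block (c := 60) (c' := 71) (K := 19) (by norm_num) (by rw [primeCounting_70])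
      (three_mul_log_le_of_pow_le (by norm_num) cert_60) (by omega) h0
  rcases lt_or_ge n 83 with h1 | h1g
  · exact block (c := 71) (c' := 83) (K := 22) (by norm_num) (by rw [primeCounting_82])
      (three_mul_log_le_of_pow_le (by norm_num) cert_71) (by omega) h1
  rcases lt_or_ge n 101 with h2 | h2g
  · exact block (c := 83) (c' := 101) (K := 25) (by norm_num) (by rw [primeCounting_100])
      (three_mul_log_le_of_pow_le (by norm_num) cert_83) (by omega) h2
  rcases lt_or_ge n 113 with h3 | h3g
  · exact block (c := 101) (c' := 113) (K := 29) (by norm_num) (by rw [primeCounting_112])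
      (three_mul_log_le_of_pow_le (by norm_num) cert_101) (by omega) h3
  rcases lt_or_ge n 131 with h4 | h4g
  · exact block (c := 113) (c' := 131) (K := 31) (by norm_num) (by rw [primeCounting_130])
      (three_mul_log_le_of_pow_le (by norm_num) cert_113) (by omega) h4
  rcases lt_or_ge n 151 with h5 | h5g
  · exact block (c := 131) (c' := 151) (K := 35) (by norm_num) (by rw [primeCounting_150])
      (three_mul_log_le_of_pow_le (by norm_num) cert_131) (by omega) h5
  rcases lt_or_ge n 179 with h6 | h6g
  · exact block (c := 151) (c' := 179) (K := 40) (by norm_num) (by rw [primeCounting_178])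
      (three_mul_log_le_of_pow_le (by norm_num) cert_151) (by omega) h6
  rcases lt_or_ge n 211 with h7 | h7g
  · exact block (c := 179) (c' := 211) (K := 46) (by norm_num) (by rw [primeCounting_210])
      (three_mul_log_le_of_pow_le (by norm_num) cert_179) (by omega) h7
  rcases lt_or_ge n 241 with h8 | h8g
  · exact block (c := 211) (c' := 241) (K := 52) (by norm_num) (by rw [primeCounting_240])
      (three_mul_log_le_of_pow_le (by norm_num) cert_211) (by omega) h8
  rcases lt_or_ge n 277 with h9 | h9g
  · exact block (c := 241) (c' := 277) (K := 58) (by norm_num) (by rw [primeCounting_276])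
      (three_mul_log_le_of_pow_le (by norm_num) cert_241) (by omega) h9
  rcases lt_or_ge n 317 with h10 | h10g
  · exact block (c := 277) (c' := 317) (K := 65) (by norm_num) (by rw [primeCounting_316])
      (three_mul_log_le_of_pow_le (by norm_num) cert_277) (by omega) h10
  rcases lt_or_ge n 373 with h11 | h11g
  · exact block (c := 317) (c' := 373) (K := 73) (by norm_num) (by rw [primeCounting_372])
      (three_mul_log_le_of_pow_le (by norm_num) cert_317) (by omega) h11
  rcases lt_or_ge n 433 with h12 | h12g
  · exact block (c := 373) (c' := 433) (K := 83) (by norm_num) (by rw [primeCounting_432])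
      (three_mul_log_le_of_pow_le (by norm_num) cert_373) (by omega) h12
  rcases lt_or_ge n 503 with h13 | h13g
  · exact block (c := 433) (c' := 503) (K := 95) (by norm_num) (by rw [primeCounting_502])
      (three_mul_log_le_of_pow_le (by norm_num) cert_433) (by omega) h13
  rcases lt_or_ge n 593 with h14 | h14g
  · exact block (c := 503) (c' := 593) (K := 107) (by norm_num) (by rw [primeCounting_592])
      (three_mul_log_le_of_pow_le (by norm_num) cert_503) (by omega) h14
  rcases lt_or_ge n 683 with h15 | h15g
  · exact block (c := 593) (c' := 683) (K := 123) (by norm_num) (by rw [primeCounting_682])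
      (three_mul_log_le_of_pow_le (by norm_num) cert_593) (by omega) h15
  rcases lt_or_ge n 809 with h16 | h16g
  · exact block (c := 683) (c' := 809) (K := 139) (by norm_num) (by rw [primeCounting_808])
      (three_mul_log_le_of_pow_le (by norm_num) cert_683) (by omega) h16
  rcases lt_or_ge n 953 with h17 | h17g
  · exact block (c := 809) (c' := 953) (K := 161) (by norm_num) (by rw [primeCounting_952])
      (three_mul_log_le_of_pow_le (by norm_num) cert_809) (by omega) h17
  exact block (c := 953) (c' := 1024) (K := 172) (by norm_num) (by rw [primeCounting_1023])
    (three_mul_log_le_of_pow_le (by norm_num) cert_953) (by omega) (by omega)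

end EtaPrmSixty

end Literature.IUT.LogVolume
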